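import Literature.AlgebraicGeometry.Frobenioids.ArithmeticFrobenioidFrobeniusCompact
import Literature.AlgebraicGeometry.Frobenioids.ArithmeticDivisorsPrimes
import HarnessLib

/-!
# Frobenioids I, Theorem 6.4 (i) (Frobenioid part): the FACT-LIST row `Thm64i_frobenioid` SETTLED —
# `_holds` at THE arithmetic Frobenioid, and the universal closure of the schema REFUTED

Mochizuki, *The geometry of Frobenioids I: the general theory*, Kyushu J. Math. **62** (2008) 293–400, Thm. 6.4
(i), kurims p. 114: "`C` [the Frobenioid of Ex. 6.3] … [is] of isotropic … and rationally standard type, but not of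
group-like type" [cite: MochizukiFrdI2008, Thm. 6.4 (i) p.114]; proof p. 115 [cite: MochizukiFrdI2008, Thm. 6.4 (i) p.115];
Def. 4.5 (ii)–(iii) p. 86 (rational / rationally standard type, over a support predicate `Supp`)
[cite: MochizukiFrdI2008, Def. 4.5 (iii) p.86].

PROOF-ONLY companion of `ArithmeticFrobenioids.lean` (cell abc-iut, seat abc-iut-f-001, F fact-proving wave,
FROZEN FACT-LIST row **F-0888** `Thm64i_frobenioid`; no definition, no statement re-typed, the declaring file is
imported, never edited).  Seat abc-iut-L1-t3 typed Thm. 6.4 (i) as the SCHEMA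
`Thm64i_frobenioid (M : ArithModelFrobenioid F K C) (R : M.ops.RSParams)` over DATA-ONLY parameters (the model
`M` and the Def. 4.5 (iii) parameters `R`: birationalization, support predicate, unit-trivialization).  This file
records the two kernel facts that settle the row under plan rule R5 ("a universal closure of a schema row is not a
fact — prove the instance forms the consumers cite"):

* `thm64i_frobenioid_holds` — the schema HOLDS at THE instance the cone consumes: THE arithmetic model Frobenioid
  `C_{F̃/F}` (`arithModelFrobenioid F K`, seat abc-iut-L6-t10) at THE parameters of Def. 4.5 (iii)
  (`PreFrobenioid.rsParams … PrimarySupp`), for EVERY number field `F` and Galois `K/F` — by seat abc-iut-L6-t10's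
  `Thm64i_frobenioid_rsParams` (`ArithmeticFrobenioidFrobeniusCompact.lean`) BY NAME; fully-qualified type.
* `not_thm64i_frobenioid_rsParams_top` — already at THE model the schema is FALSE for a junk support predicate
  (`Supp := ⊤`: then no object is rational in the sense of Def. 4.5 (ii), because every `Φ(L)`, `L` a number field,
  has a prime — the class of the divisor supported at an archimedean place, `EffArithDivisor.isPrimary_single`);
* `not_thm64i_frobenioid_univ` — hence the universal closure of the schema (over `F, K, C, M, R`, at the universe
  levels of THE model) is FALSE: the row is consumable AT THE NAMED INSTANCE ONLY (`thm64i_frobenioid_holds`).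

HONEST LABEL: the typed decl covers the clause for `C` itself; the printed variants for `C^pf`, `C^rlf`, `C^un-tr`,
`(C^pf)^un-tr` are Prop. 5.5 (iii)'s (sub-DAG row T64i/L11, not this row).  Nothing here bears on [IUTchIII]
Cor. 3.12 or asserts anything about abc; no side taken.
-/

noncomputable section

namespace Literature.AlgebraicGeometry.Frobenioids

open CategoryTheory NumberField

universe u v

section F0888

variable (F : Type) [Field F] [NumberField F] (K : Type) [Field K] [Algebra F K]

/-- Every divisor monoid `Φ(Spec L)` of THE arithmetic Frobenioid has a prime (Ex. 6.3 p. 113: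
`Prime(Φ(L)) ≃ V(L) ≠ ∅`): the class of the effective arithmetic divisor supported at an archimedean place of the
number field `L`. [cite: MochizukiFrdI2008, Ex. 6.3 p.113] -/
theorem nonempty_primes_arithFrobenioidOps_mon (X : FinSubextCat F K) :
    Nonempty (Primes ((arithFrobenioidOps F K).Mon X)) := by
  obtain ⟨w⟩ := (inferInstance : Nonempty (InfinitePlace X.L))
  exact ⟨Quotient.mk (primarySetoid _)
    ⟨Multiplicative.ofAdd (EffArithDivisor.single X.L (Sum.inl w)), EffArithDivisor.isPrimary_single (Sum.inl w)⟩⟩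

variable [IsGalois F K]

/-- **FACT-LIST row F-0888 `Thm64i_frobenioid` HOLDS at THE instance** ([FrdI] Thm. 6.4 (i), kurims p. 114:
"`C` … [is] of isotropic and rationally standard type, but not of group-like type"): seat abc-iut-L1-t3's schema at
THE arithmetic model Frobenioid `C_{F̃/F}` of Ex. 6.3 / Thm. 6.4 (`arithModelFrobenioid F K`) and THE parameters of
Def. 4.5 (iii) (`PreFrobenioid.rsParams`, support = Def. 2.4 (i)(d) `PrimarySupp`), for every number field `F` and
Galois extension `K/F` — seat abc-iut-L6-t10's `Thm64i_frobenioid_rsParams` BY NAME (fully-qualified type; R5: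
instance form, the universal closure being false, `not_thm64i_frobenioid_univ`).
[cite: MochizukiFrdI2008, Thm. 6.4 (i) p.114] -/
theorem thm64i_frobenioid_holds :
    Literature.AlgebraicGeometry.Frobenioids.Thm64i_frobenioid (arithModelFrobenioid F K)
      (PreFrobenioid.rsParams (arithFrobenioid_isFrobenioid F K) fun a 𝔭 => PrimarySupp a 𝔭) :=
  Thm64i_frobenioid_rsParams F K

/-- **R5 evidence, at THE model**: the schema `Thm64i_frobenioid (arithModelFrobenioid F K) R` is FALSE for the
Def. 4.5 (iii) parameters with the JUNK support predicate `Supp := ⊤` (everything lies in every support): then no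
object `A` is rational (Def. 4.5 (ii) asks, for each prime `𝔭` of `Φ(Base A')`, for `b ∈ Φ` with `𝔭 ∉ Supp(b)`,
and `Φ(Base A')` has a prime), so "rationally standard type" fails.  The schema is faithful to print only at THE
support of Def. 2.4 (i)(d) (`thm64i_frobenioid_holds`). [cite: MochizukiFrdI2008, Def. 4.5 (iii) p.86] -/
theorem not_thm64i_frobenioid_rsParams_top :
    ¬ Literature.AlgebraicGeometry.Frobenioids.Thm64i_frobenioid (arithModelFrobenioid F K)
        (PreFrobenioid.rsParams (arithFrobenioid_isFrobenioid F K) fun _ _ => True) := by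
  intro h
  obtain ⟨A', -, -, hsr⟩ := ((Thm64i_frobenioid_arith_iff F K _).mp h).2.1 ⟨⟨⊥⟩, 1⟩
  obtain ⟨𝔭⟩ := nonempty_primes_arithFrobenioidOps_mon F K ((arithFrobenioidOps F K).base.obj A')
  obtain ⟨_, _, -, -, hnot⟩ := hsr 𝔭
  exact hnot True.intro

end F0888

/-- **The universal closure of the schema `Thm64i_frobenioid` is FALSE** (plan rule R5: FACT-LIST row F-0888 is
consumable AT THE NAMED INSTANCE ONLY, `thm64i_frobenioid_holds`): quantified over all number fields `F`, Galois
`K/F`, categories `C`, data `M : ArithModelFrobenioid F K C` and parameters `R` (at the universe levels of THE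
model), it fails at `F = K = ℚ`, THE model and the junk support `⊤` (`not_thm64i_frobenioid_rsParams_top`).
[cite: MochizukiFrdI2008, Thm. 6.4 (i) p.114] -/
theorem not_thm64i_frobenioid_univ :
    ¬ ∀ (F : Type) [Field F] [NumberField F] (K : Type) [Field K] [Algebra F K] [IsGalois F K]
        (C : Type) [Category.{0} C] (M : ArithModelFrobenioid F K C)
        (R : PreFrobenioidData.RSParams.{0, 0, 0, 0, 0, 0} M.ops),
        Literature.AlgebraicGeometry.Frobenioids.Thm64i_frobenioid M R :=
  fun h => not_thm64i_frobenioid_rsParams_top ℚ ℚ (h ℚ ℚ (arithFrobenioid ℚ ℚ) (arithModelFrobenioid ℚ ℚ) _)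

end Literature.AlgebraicGeometry.Frobenioids

end
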